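import Literature.NumberTheory.EllipticCurves.TwoDescentOneRootCharacter
import HarnessLib

/-!
# The one-root `2`-descent map is the Kummer map: `kummerEquiv ∘ H¹(χ_θ) ∘ κ = (x − θ)`
# (Cassels, *Lectures on Elliptic Curves*, §15; Silverman AEC Thm. X.1.1 for ONE rational root)

Sequel of `TwoDescentOneRootCharacter.lean` (the character `χ_θ : E[2] → μ₂` of ONE rational `2`-torsion
point `T_θ` and `H¹(χ_θ) : H¹(K, E[2]) → H¹(K, μ₂)`) and the one-root twin of `TwoDescentKummerBridge.lean`
(which assumes SPLIT `2`-torsion `e₁, e₂, e₃ ∈ K`). Setting: an elliptic curve `E/K`, `char K = 0`, and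
`θ ∈ K` with `Ψ₂(θ) = 0` (`IsTwoTorsionX`); the other two roots `e₂, e₃` of the `2`-division cubic live in
`K̄` and may be conjugate over `K`. For `P ∈ E(K)` let `κ(P) = [σ ↦ σQ − Q] ∈ H¹(K, E[2])` be its Kummer class
(tree `kummerMapTorsion`, `2Q = P`). Then

* `oneRootCharH1_kummerMapTorsion_of_ne` / `_of_eq` / `_zero`: `H¹(χ_θ)(κ P) ∈ H¹(K, μ₂)` is the Kummer class
  (`kummerMap K 2`) of `x(P) − θ` for `x(P) ≠ θ`, of `c(θ) = 3θ² + (b₂/2)θ + b₄/2` (`oneRootConst`, the value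
  `(θ − e₂)(θ − e₃)`) at `P = T_θ`, and of `1` at `O`;
* **`kummerEquiv_oneRootCharH1_kummerMapTorsion`**: `kummerEquiv K 2 (H¹(χ_θ)(κ P)) = oneRootComponent θ P`
  in `Kˣ/Kˣ²` — the cohomological Kummer map followed by `H¹(χ_θ)` and Kummer theory IS Cassels' one-root
  descent map `P ↦ x(P) − θ` of `TwoDescentOneRoot.lean` (`kummerEquiv_oneRootCharH1_kummerMapTorsion_eq_oneRootHom`).

Proof (Silverman AEC X.1, proof of Thm. X.1.1, run over `K̄` where the cubic splits as
`4(x − θ)(x − e₂)(x − e₃)`, `IsTwoTorsionX.exists_splitTwoTorsion`): the explicit halving point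
`Q(u₁, u₂, u₃) ∈ E(K̄)` of `P = (x₀, y₀)` (`uᵢ² = x₀ − eᵢ`, `u₁u₂u₃ = y₀ + (a₁x₀ + a₃)/2`; the tree's
`Affine.Point.nonsingular_halving` / `halving_add_self` / `halving_add_twoTorsionᵢ` of
`TwoDescentHalvingGalois.lean`, valid over any field with split `2`-torsion) satisfies `2Q = P`. A
`K`-automorphism `τ` of `K̄` fixes `θ` but may SWAP `e₂ ↔ e₃` (`apply_root₂_eq_or`: `τe₂ ∈ {e₂, e₃}` since
`e₂ + e₃, e₂e₃ ∈ K`); in either case `τQ(u₁, u₂, u₃) = Q(v₁, v₂, v₃)` with `v₁ = τu₁ = ±u₁` and `{v₂, v₃}`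
the images `{τu₂, τu₃}` REORDERED so that `vᵢ² = uᵢ²` (`exists_conj_halving_data`; the coordinates of `Q`
are symmetric in `u₂, u₃`), `v₁v₂v₃ = u₁u₂u₃`. Hence (`sign_cases_of_sq_eq`) `(vᵢ) = (sᵢuᵢ)` with an even
number of signs `sᵢ = −1`, `τQ − Q ∈ {O, T_θ, T₂, T₃}` accordingly, and
**`χ_θ(τQ − Q) = s₁ = τ(u₁)/u₁`** (`exists_sign_muVal_oneRootChar_smul_halving_sub`) — the Kummer cocycle of
`u₁ = √(x₀ − θ)`. At `P = T_θ` (`u₁ = 0`) the same sign is `τ(u₂u₃)/(u₂u₃)` with `(u₂u₃)² = c(θ)`.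

All statements hold over any field of characteristic `0`, in particular verbatim over completions `K_v`
(the local half of the identification of `Sel⁽²⁾(E/K)` inside `Kˣ/Kˣ²` through one root, sequel). Theorems
only; no named fact, no `sorry`. Seat `bsd-line-spt-p1` (g29), milestone S3 of the `2`-Selmer upgrade of
the kernel general `2`-descent (`Ш(E/ℚ)[2] = 0` doors for curves with irreducible `E[2]`).

## References

* [Cassels1991LecturesEllipticCurves] J. W. S. Cassels, *Lectures on Elliptic Curves*, LMSST 24, CUP 1991,
  §15 (pp. 42–44: the map `μ`, `μ(a, b) = a − Θ`).
* [SilvermanAEC2009] J. H. Silverman, *The Arithmetic of Elliptic Curves*, 2nd ed., GTM 106, Springer 2009,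
  Thm. X.1.1 (proof: `σQ − Q` records the signs `σ(√(x₀ − eᵢ))/√(x₀ − eᵢ)`), Prop. X.1.4, VIII.§2.
* [Knapp1993] A. W. Knapp, *Elliptic Curves*, Princeton 1993, Thm. 4.2 (explicit halving).
* [SerreGaloisCohomology1997] J.-P. Serre, *Galois Cohomology*, Springer 1997, I.§2.4, II.§1.2.
-/

noncomputable section

open scoped Classical

universe u

namespace WeierstrassCurve

open Literature.NumberTheory.GaloisRepresentations Literature.NumberTheory.EllipticCurves Field
open WeierstrassCurve.Affine

variable {K : Type u} [Field K] [CharZero K] (W : WeierstrassCurve K) [W.IsElliptic] {θ : K}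

/-! ### Sign patterns of square roots with a fixed product -/

/-- **Even sign patterns.** If `vᵢ² = uᵢ²` (`i = 1, 2, 3`) and `v₁v₂v₃ = u₁u₂u₃` in `K̄` (`char K = 0`),
then one of `(u₁, u₂, u₃)`, `(u₁, −u₂, −u₃)`, `(−u₁, u₂, −u₃)`, `(−u₁, −u₂, u₃)` is `(v₁, v₂, v₃)` (a vanishing
`uᵢ` has both signs and absorbs the parity). [cite: SilvermanAEC2009, Thm. X.1.1 (proof)] -/
theorem sign_cases_of_sq_eq {u₁ u₂ u₃ v₁ v₂ v₃ : AlgebraicClosure K}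
    (h₁ : v₁ ^ 2 = u₁ ^ 2) (h₂ : v₂ ^ 2 = u₂ ^ 2) (h₃ : v₃ ^ 2 = u₃ ^ 2)
    (hprod : v₁ * v₂ * v₃ = u₁ * u₂ * u₃) :
    (v₁ = u₁ ∧ v₂ = u₂ ∧ v₃ = u₃) ∨ (v₁ = u₁ ∧ v₂ = -u₂ ∧ v₃ = -u₃) ∨
      (v₁ = -u₁ ∧ v₂ = u₂ ∧ v₃ = -u₃) ∨ (v₁ = -u₁ ∧ v₂ = -u₂ ∧ v₃ = u₃) := by
  have e1 := sq_eq_sq_iff_eq_or_eq_neg.mp h₁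
  have e2 := sq_eq_sq_iff_eq_or_eq_neg.mp h₂
  have e3 := sq_eq_sq_iff_eq_or_eq_neg.mp h₃
  -- in the four "odd" cases the product `u₁u₂u₃` vanishes, and a vanishing `uᵢ` has both signs
  have key : ∀ v : AlgebraicClosure K, -v = v → v = 0 := by
    intro v hv
    have h2v : (2 : AlgebraicClosure K) * v = 0 := by linear_combination -hv
    exact (mul_eq_zero.mp h2v).resolve_left two_ne_zero
  have hzero : ∀ {v w : AlgebraicClosure K}, w = 0 → (v = w ∨ v = -w) → v = w ∧ v = -w := by
    intro v w hw hv
    subst hw; simp only [neg_zero, or_self] at hv; simp [hv]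
  rcases e1 with f1 | f1 <;> rcases e2 with f2 | f2 <;> rcases e3 with f3 | f3
  · exact Or.inl ⟨f1, f2, f3⟩
  · -- `(+, +, -)`
    have h0 : u₁ * u₂ * u₃ = 0 := by
      rw [f1, f2, f3] at hprod
      exact key _ (by linear_combination hprod)
    rcases mul_eq_zero.mp h0 with h0 | h0
    · rcases mul_eq_zero.mp h0 with h0 | h0
      · exact Or.inr (Or.inr (Or.inl ⟨(hzero h0 (Or.inl f1)).2, f2, f3⟩))
      · exact Or.inr (Or.inl ⟨f1, (hzero h0 (Or.inl f2)).2, f3⟩)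
    · exact Or.inl ⟨f1, f2, (hzero h0 (Or.inr f3)).1⟩
  · -- `(+, -, +)`
    have h0 : u₁ * u₂ * u₃ = 0 := by
      rw [f1, f2, f3] at hprod
      exact key _ (by linear_combination hprod)
    rcases mul_eq_zero.mp h0 with h0 | h0
    · rcases mul_eq_zero.mp h0 with h0 | h0
      · exact Or.inr (Or.inr (Or.inr ⟨(hzero h0 (Or.inl f1)).2, f2, f3⟩))
      · exact Or.inl ⟨f1, (hzero h0 (Or.inr f2)).1, f3⟩
    · exact Or.inr (Or.inl ⟨f1, f2, (hzero h0 (Or.inl f3)).2⟩)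
  · exact Or.inr (Or.inl ⟨f1, f2, f3⟩)
  · -- `(-, +, +)`
    have h0 : u₁ * u₂ * u₃ = 0 := by
      rw [f1, f2, f3] at hprod
      exact key _ (by linear_combination hprod)
    rcases mul_eq_zero.mp h0 with h0 | h0
    · rcases mul_eq_zero.mp h0 with h0 | h0
      · exact Or.inl ⟨(hzero h0 (Or.inr f1)).1, f2, f3⟩
      · exact Or.inr (Or.inr (Or.inr ⟨f1, (hzero h0 (Or.inl f2)).2, f3⟩))
    · exact Or.inr (Or.inr (Or.inl ⟨f1, f2, (hzero h0 (Or.inl f3)).2⟩))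
  · exact Or.inr (Or.inr (Or.inl ⟨f1, f2, f3⟩))
  · exact Or.inr (Or.inr (Or.inr ⟨f1, f2, f3⟩))
  · -- `(-, -, -)`
    have h0 : u₁ * u₂ * u₃ = 0 := by
      rw [f1, f2, f3] at hprod
      exact key _ (by linear_combination hprod)
    rcases mul_eq_zero.mp h0 with h0 | h0
    · rcases mul_eq_zero.mp h0 with h0 | h0
      · exact Or.inr (Or.inl ⟨(hzero h0 (Or.inr f1)).1, f2, f3⟩)
      · exact Or.inr (Or.inr (Or.inl ⟨f1, (hzero h0 (Or.inr f2)).1, f3⟩))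
    · exact Or.inr (Or.inr (Or.inr ⟨f1, f2, (hzero h0 (Or.inr f3)).1⟩))

/-! ### The roots `e₂, e₃ ∈ K̄` and their Galois conjugates -/

omit [W.IsElliptic] in
/-- `e₂ + e₃ = −b₂/4 − θ ∈ K` for the splitting `Ψ₂ = 4(x − θ)(x − e₂)(x − e₃)` over `K̄`
(`b₂ = −4(θ + e₂ + e₃)`). [cite: SilvermanAEC2009, III.§1 (p. 42) and Prop. X.1.4] -/
theorem root₂_add_root₃_eq {e₂ e₃ : AlgebraicClosure K}
    (hs : (W.baseChange (AlgebraicClosure K)).toAffine.SplitTwoTorsion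
      (algebraMap K (AlgebraicClosure K) θ) e₂ e₃) :
    e₂ + e₃ = algebraMap K (AlgebraicClosure K) (-(W.b₂ / 4) - θ) := by
  have hb := hs.b₂_eq
  have hb' : (W.baseChange (AlgebraicClosure K)).b₂ = algebraMap K (AlgebraicClosure K) W.b₂ := by
    simp only [baseChange, map_b₂]
  rw [hb'] at hb
  simp only [map_sub, map_neg, map_div₀, map_ofNat]
  linear_combination ((1 : AlgebraicClosure K) / 4) * hb

omit [W.IsElliptic] in
/-- `e₂e₃ = θ² + (b₂/4)θ + b₄/2 ∈ K` (`b₄ = 2(θe₂ + θe₃ + e₂e₃)`). [cite: SilvermanAEC2009, III.§1 (p. 42) and Prop. X.1.4] -/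
theorem root₂_mul_root₃_eq {e₂ e₃ : AlgebraicClosure K}
    (hs : (W.baseChange (AlgebraicClosure K)).toAffine.SplitTwoTorsion
      (algebraMap K (AlgebraicClosure K) θ) e₂ e₃) :
    e₂ * e₃ = algebraMap K (AlgebraicClosure K) (θ ^ 2 + W.b₂ / 4 * θ + W.b₄ / 2) := by
  have hb := hs.b₂_eq
  have hb4 := hs.b₄_eq
  have hb' : (W.baseChange (AlgebraicClosure K)).b₂ = algebraMap K (AlgebraicClosure K) W.b₂ := by
    simp only [baseChange, map_b₂]
  have hb4' : (W.baseChange (AlgebraicClosure K)).b₄ = algebraMap K (AlgebraicClosure K) W.b₄ := by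
    simp only [baseChange, map_b₄]
  rw [hb'] at hb
  rw [hb4'] at hb4
  simp only [map_add, map_mul, map_div₀, map_pow, map_ofNat]
  linear_combination (-(algebraMap K (AlgebraicClosure K) θ) / 4) * hb +
    (-(1 : AlgebraicClosure K) / 2) * hb4

omit [W.IsElliptic] in
/-- **A `K`-automorphism of `K̄` permutes `{e₂, e₃}`**: `τe₂ = e₂` and `τe₃ = e₃`, or `τe₂ = e₃` and
`τe₃ = e₂` (`τe₂` is a root of `(X − e₂)(X − e₃) ∈ K[X]`). [cite: SilvermanAEC2009, Thm. X.1.1 (proof), VIII.§1] -/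
theorem apply_root₂_eq_or {e₂ e₃ : AlgebraicClosure K}
    (hs : (W.baseChange (AlgebraicClosure K)).toAffine.SplitTwoTorsion
      (algebraMap K (AlgebraicClosure K) θ) e₂ e₃)
    (τ : AlgebraicClosure K ≃ₐ[K] AlgebraicClosure K) :
    (τ e₂ = e₂ ∧ τ e₃ = e₃) ∨ (τ e₂ = e₃ ∧ τ e₃ = e₂) := by
  have hS := W.root₂_add_root₃_eq hs
  have hP := W.root₂_mul_root₃_eq hs
  have hτS : τ (e₂ + e₃) = e₂ + e₃ := by rw [hS, AlgEquiv.commutes]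
  have hτP : τ (e₂ * e₃) = e₂ * e₃ := by rw [hP, AlgEquiv.commutes]
  rw [map_add] at hτS
  rw [map_mul] at hτP
  have hquad : (τ e₂ - e₂) * (τ e₂ - e₃) = 0 := by
    linear_combination τ e₂ * hτS - hτP
  rcases mul_eq_zero.mp hquad with h2 | h2
  · left
    refine ⟨sub_eq_zero.mp h2, ?_⟩
    have := hτS
    rw [sub_eq_zero.mp h2] at this
    linear_combination this
  · right
    refine ⟨sub_eq_zero.mp h2, ?_⟩
    have := hτS
    rw [sub_eq_zero.mp h2] at this
    linear_combination this

/-! ### The halving point over `K̄` and its Galois conjugates -/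

/-- **The halving point is on the curve** (over `K̄`, where one root splits the cubic): for `uᵢ` with
`u₁² = x₀ − θ`, `u₂² = x₀ − e₂`, `u₃² = x₀ − e₃`, the point
`Q(u₁, u₂, u₃) = (x₀ + u₁u₂ + u₁u₃ + u₂u₃, (u₁ + u₂)(u₁ + u₃)(u₂ + u₃) − (a₁x + a₃)/2)` is a nonsingular
point of `E/K̄`. [cite: Knapp1993, Thm. 4.2] -/
theorem nonsingular_oneRootHalving {e₂ e₃ : AlgebraicClosure K}
    (hs : (W.baseChange (AlgebraicClosure K)).toAffine.SplitTwoTorsion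
      (algebraMap K (AlgebraicClosure K) θ) e₂ e₃)
    {x₀ : K} {u₁ u₂ u₃ : AlgebraicClosure K}
    (hu₁ : algebraMap K (AlgebraicClosure K) x₀ - algebraMap K (AlgebraicClosure K) θ = u₁ ^ 2)
    (hu₂ : algebraMap K (AlgebraicClosure K) x₀ - e₂ = u₂ ^ 2)
    (hu₃ : algebraMap K (AlgebraicClosure K) x₀ - e₃ = u₃ ^ 2) :
    (W.baseChange (AlgebraicClosure K)).toAffine.Nonsingular
      (algebraMap K (AlgebraicClosure K) x₀ + u₁ * u₂ + u₁ * u₃ + u₂ * u₃)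
      ((u₁ + u₂) * (u₁ + u₃) * (u₂ + u₃) -
        ((W.baseChange (AlgebraicClosure K)).a₁ *
          (algebraMap K (AlgebraicClosure K) x₀ + u₁ * u₂ + u₁ * u₃ + u₂ * u₃) +
          (W.baseChange (AlgebraicClosure K)).a₃) / 2) := by
  haveI := W.isElliptic_baseChange (AlgebraicClosure K)
  exact Affine.Point.nonsingular_halving hs hu₁ hu₂ hu₃

/-- **`2 • Q(u) = P`** in `E(K̄)` for the halving point of `P = (x₀, y₀) ∈ E(K)`, the signs normalised by
`u₁u₂u₃ = y₀ + (a₁x₀ + a₃)/2`. [cite: Knapp1993, Thm. 4.2] -/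
theorem two_zsmul_oneRootHalving {e₂ e₃ : AlgebraicClosure K}
    (hs : (W.baseChange (AlgebraicClosure K)).toAffine.SplitTwoTorsion
      (algebraMap K (AlgebraicClosure K) θ) e₂ e₃)
    {x₀ y₀ : K} (h₀ : W.toAffine.Nonsingular x₀ y₀) {u₁ u₂ u₃ : AlgebraicClosure K}
    (hu₁ : algebraMap K (AlgebraicClosure K) x₀ - algebraMap K (AlgebraicClosure K) θ = u₁ ^ 2)
    (hu₂ : algebraMap K (AlgebraicClosure K) x₀ - e₂ = u₂ ^ 2)
    (hu₃ : algebraMap K (AlgebraicClosure K) x₀ - e₃ = u₃ ^ 2)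
    (hy₀ : algebraMap K (AlgebraicClosure K) (y₀ + (W.a₁ * x₀ + W.a₃) / 2) = u₁ * u₂ * u₃)
    {Q : geomPoints W} (hQ : Q = Affine.Point.some _ _ (W.nonsingular_oneRootHalving hs hu₁ hu₂ hu₃)) :
    (2 : ℤ) • Q = toGeomPoints W (Affine.Point.some x₀ y₀ h₀) := by
  haveI := W.isElliptic_baseChange (AlgebraicClosure K)
  subst hQ
  rw [two_zsmul]
  have h₀' : (W.baseChange (AlgebraicClosure K)).toAffine.Nonsingular
      (algebraMap K (AlgebraicClosure K) x₀) (algebraMap K (AlgebraicClosure K) y₀) :=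
    (Affine.map_nonsingular (W := W.toAffine) (algebraMap K (AlgebraicClosure K)).injective x₀
      y₀).mpr h₀
  have hy₀' : algebraMap K (AlgebraicClosure K) y₀ +
      ((W.baseChange (AlgebraicClosure K)).a₁ * algebraMap K (AlgebraicClosure K) x₀ +
        (W.baseChange (AlgebraicClosure K)).a₃) / 2 = u₁ * u₂ * u₃ := by
    rw [← hy₀]
    simp only [map_add, map_div₀, map_mul, map_ofNat, baseChange, map_a₁, map_a₃]
  exact Affine.Point.halving_add_self hs h₀' hu₁ hu₂ hu₃ hy₀'

/-- **A Galois conjugate of the halving point is a halving point**: if `σu₁ = v₁` and either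
`(σu₂, σu₃) = (v₂, v₃)` (`σ` fixes `e₂, e₃`) or `(σu₂, σu₃) = (v₃, v₂)` (`σ` swaps `e₂, e₃`), then
`σ • Q(u₁, u₂, u₃) = Q(v₁, v₂, v₃)` — the coordinates of `Q` are symmetric in `(u₂, u₃)`.
[cite: SilvermanAEC2009, Thm. X.1.1 (proof)] -/
theorem smul_oneRootHalving {e₂ e₃ : AlgebraicClosure K}
    (hs : (W.baseChange (AlgebraicClosure K)).toAffine.SplitTwoTorsion
      (algebraMap K (AlgebraicClosure K) θ) e₂ e₃)
    (σ : absoluteGaloisGroup K) {x₀ : K} {u₁ u₂ u₃ v₁ v₂ v₃ : AlgebraicClosure K}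
    (hu₁ : algebraMap K (AlgebraicClosure K) x₀ - algebraMap K (AlgebraicClosure K) θ = u₁ ^ 2)
    (hu₂ : algebraMap K (AlgebraicClosure K) x₀ - e₂ = u₂ ^ 2)
    (hu₃ : algebraMap K (AlgebraicClosure K) x₀ - e₃ = u₃ ^ 2)
    (hv₁ : algebraMap K (AlgebraicClosure K) x₀ - algebraMap K (AlgebraicClosure K) θ = v₁ ^ 2)
    (hv₂ : algebraMap K (AlgebraicClosure K) x₀ - e₂ = v₂ ^ 2)
    (hv₃ : algebraMap K (AlgebraicClosure K) x₀ - e₃ = v₃ ^ 2)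
    (h₁ : σ • u₁ = v₁) (h₂₃ : (σ • u₂ = v₂ ∧ σ • u₃ = v₃) ∨ (σ • u₂ = v₃ ∧ σ • u₃ = v₂))
    {Q : geomPoints W} (hQ : Q = Affine.Point.some _ _ (W.nonsingular_oneRootHalving hs hu₁ hu₂ hu₃)) :
    σ • Q = Affine.Point.some _ _ (W.nonsingular_oneRootHalving hs hv₁ hv₂ hv₃) := by
  subst hQ
  set τ : AlgebraicClosure K ≃ₐ[K] AlgebraicClosure K := σ
  have hτ₁ : τ u₁ = v₁ := h₁
  show Affine.Point.map (W' := W) (τ : AlgebraicClosure K →ₐ[K] AlgebraicClosure K)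
    (Affine.Point.some _ _ (W.nonsingular_oneRootHalving hs hu₁ hu₂ hu₃)) = _
  rw [Affine.Point.map_some]
  simp only [Affine.Point.some.injEq, AlgEquiv.coe_toAlgHom]
  rcases h₂₃ with ⟨h₂, h₃⟩ | ⟨h₂, h₃⟩
  · have hτ₂ : τ u₂ = v₂ := h₂
    have hτ₃ : τ u₃ = v₃ := h₃
    constructor
    · simp only [map_add, map_mul, τ.commutes, hτ₁, hτ₂, hτ₃]
    · simp only [map_sub, map_div₀, map_add, map_mul, map_ofNat, τ.commutes, hτ₁, hτ₂, hτ₃,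
        baseChange, map_a₁, map_a₃]
  · have hτ₂ : τ u₂ = v₃ := h₂
    have hτ₃ : τ u₃ = v₂ := h₃
    constructor
    · simp only [map_add, map_mul, τ.commutes, hτ₁, hτ₂, hτ₃]
      ring
    · simp only [map_sub, map_div₀, map_add, map_mul, map_ofNat, τ.commutes, hτ₁, hτ₂, hτ₃,
        baseChange, map_a₁, map_a₃]
      ring

omit [W.IsElliptic] in
/-- **Conjugate halving data, reordered.** For a `K`-automorphism `τ` of `K̄` and halving data `(uᵢ)` of
`x₀ ∈ K` (`u₁² = x₀ − θ`, `u₂² = x₀ − e₂`, `u₃² = x₀ − e₃`) there are `v₂, v₃` with `v₂² = x₀ − e₂`,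
`v₃² = x₀ − e₃`, `{v₂, v₃} = {τu₂, τu₃}` in the order dictated by `τ` on `{e₂, e₃}`, and `v₂v₃ = τ(u₂u₃)`.
[cite: SilvermanAEC2009, Thm. X.1.1 (proof)] -/
theorem exists_conj_halving_data {e₂ e₃ : AlgebraicClosure K}
    (hs : (W.baseChange (AlgebraicClosure K)).toAffine.SplitTwoTorsion
      (algebraMap K (AlgebraicClosure K) θ) e₂ e₃)
    (σ : absoluteGaloisGroup K) {x₀ : K} {u₂ u₃ : AlgebraicClosure K}
    (hu₂ : algebraMap K (AlgebraicClosure K) x₀ - e₂ = u₂ ^ 2)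
    (hu₃ : algebraMap K (AlgebraicClosure K) x₀ - e₃ = u₃ ^ 2) :
    ∃ v₂ v₃ : AlgebraicClosure K,
      algebraMap K (AlgebraicClosure K) x₀ - e₂ = v₂ ^ 2 ∧
      algebraMap K (AlgebraicClosure K) x₀ - e₃ = v₃ ^ 2 ∧
      ((σ • u₂ = v₂ ∧ σ • u₃ = v₃) ∨ (σ • u₂ = v₃ ∧ σ • u₃ = v₂)) ∧ σ • (u₂ * u₃) = v₂ * v₃ := by
  set τ : AlgebraicClosure K ≃ₐ[K] AlgebraicClosure K := σ
  have hx : τ (algebraMap K (AlgebraicClosure K) x₀) = algebraMap K (AlgebraicClosure K) x₀ :=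
    τ.commutes x₀
  rcases W.apply_root₂_eq_or hs τ with ⟨h2, h3⟩ | ⟨h2, h3⟩
  · refine ⟨τ u₂, τ u₃, ?_, ?_, Or.inl ⟨rfl, rfl⟩, ?_⟩
    · rw [← map_pow, ← hu₂, map_sub, hx, h2]
    · rw [← map_pow, ← hu₃, map_sub, hx, h3]
    · exact map_mul τ u₂ u₃
  · refine ⟨τ u₃, τ u₂, ?_, ?_, Or.inr ⟨rfl, rfl⟩, ?_⟩
    · rw [← map_pow, ← hu₃, map_sub, hx, h3]
    · rw [← map_pow, ← hu₂, map_sub, hx, h2]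
    · rw [mul_comm (τ u₃)]
      exact map_mul τ u₂ u₃

/-! ### The value of `χ_θ` on the Kummer cocycle of the halving point -/

/-- **The Kummer cocycle of `P`, read through `χ_θ`, is the sign `σ(u₁)/u₁`.** For the halving point
`Q = Q(u₁, u₂, u₃) ∈ E(K̄)` of `P = (x₀, y₀) ∈ E(K)` (`u₁u₂u₃ ∈ K`) and `σ ∈ Γ_K`: `χ_θ(σQ − Q) = s` where
`s = ±1` is the common sign with `σu₁ = s·u₁` and `σ(u₂u₃) = s·u₂u₃` (Silverman AEC X.1, proof of
Thm. X.1.1, for one rational root: `σQ − Q ∈ {O, T_θ}` iff `σ` fixes `√(x₀ − θ)`; `σ` may swap the two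
irrational roots `e₂, e₃`, which the symmetric shape of `Q` absorbs). [cite: SilvermanAEC2009, Thm. X.1.1] -/
theorem exists_sign_muVal_oneRootChar_smul_halving_sub (h : W.toAffine.IsTwoTorsionX θ)
    {e₂ e₃ : AlgebraicClosure K}
    (hs : (W.baseChange (AlgebraicClosure K)).toAffine.SplitTwoTorsion
      (algebraMap K (AlgebraicClosure K) θ) e₂ e₃)
    (σ : absoluteGaloisGroup K) {x₀ c : K} {u₁ u₂ u₃ : AlgebraicClosure K}
    (hu₁ : algebraMap K (AlgebraicClosure K) x₀ - algebraMap K (AlgebraicClosure K) θ = u₁ ^ 2)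
    (hu₂ : algebraMap K (AlgebraicClosure K) x₀ - e₂ = u₂ ^ 2)
    (hu₃ : algebraMap K (AlgebraicClosure K) x₀ - e₃ = u₃ ^ 2)
    (hy : algebraMap K (AlgebraicClosure K) c = u₁ * u₂ * u₃)
    {Q : geomPoints W} (hQ : Q = Affine.Point.some _ _ (W.nonsingular_oneRootHalving hs hu₁ hu₂ hu₃))
    (hmem : σ • Q - Q ∈ geomTorsion W 2) :
    ∃ s : AlgebraicClosure K, (s = 1 ∨ s = -1) ∧
      ((muVal K 2 (W.oneRootChar h ⟨_, hmem⟩) : (AlgebraicClosure K)ˣ) : AlgebraicClosure K) = s ∧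
      σ • u₁ = s * u₁ ∧ σ • (u₂ * u₃) = s * (u₂ * u₃) := by
  haveI := W.isElliptic_baseChange (AlgebraicClosure K)
  set τ : AlgebraicClosure K ≃ₐ[K] AlgebraicClosure K := σ
  -- the conjugate data `(v₁, v₂, v₃)`, reordered
  obtain ⟨v₂, v₃, hv₂, hv₃, h₂₃, hprod₂₃⟩ := W.exists_conj_halving_data hs σ hu₂ hu₃
  have hv₁ : algebraMap K (AlgebraicClosure K) x₀ - algebraMap K (AlgebraicClosure K) θ = (σ • u₁) ^ 2 := by
    change _ = (τ u₁) ^ 2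
    rw [← map_pow, ← hu₁, map_sub, τ.commutes, τ.commutes]
  -- the sign pattern
  have hsq₁ : (σ • u₁) ^ 2 = u₁ ^ 2 := by rw [← hv₁, hu₁]
  have hsq₂ : v₂ ^ 2 = u₂ ^ 2 := by rw [← hv₂, hu₂]
  have hsq₃ : v₃ ^ 2 = u₃ ^ 2 := by rw [← hv₃, hu₃]
  have hprod : σ • u₁ * v₂ * v₃ = u₁ * u₂ * u₃ := by
    rw [mul_assoc, ← hprod₂₃, ← smul_mul', ← mul_assoc, ← hy]
    exact τ.commutes c
  have hcases := sign_cases_of_sq_eq (K := K) hsq₁ hsq₂ hsq₃ hprod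
  rw [oneRootChar_apply, muVal_oneRootCharFun]
  -- the four `2`-torsion points over `K̄`
  have hT : W.geomOneRoot h = Affine.Point.some _ _ (Affine.nonsingular_twoTorsion hs) := rfl
  set T₂ : geomPoints W := Affine.Point.some _ _ (Affine.nonsingular_twoTorsion hs.swap₁₂) with hT₂
  set T₃ : geomPoints W := Affine.Point.some _ _ (Affine.nonsingular_twoTorsion hs.swap₂₃.swap₁₂) with hT₃
  have h20 : T₂ ≠ 0 := Affine.Point.some_ne_zero _
  have h30 : T₃ ≠ 0 := Affine.Point.some_ne_zero _
  have h21 : T₂ ≠ W.geomOneRoot h := by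
    rw [hT, hT₂]; intro heq
    exact hs.ne₁₂ (Affine.Point.some.inj heq).1.symm
  have h31 : T₃ ≠ W.geomOneRoot h := by
    rw [hT, hT₃]; intro heq
    exact hs.ne₁₃ (Affine.Point.some.inj heq).1.symm
  rcases hcases with ⟨e1, e2, e3⟩ | ⟨e1, e2, e3⟩ | ⟨e1, e2, e3⟩ | ⟨e1, e2, e3⟩ <;>
    rw [e2] at hv₂ h₂₃ <;> rw [e3] at hv₃ h₂₃
  · -- `σQ = Q`
    have hσ : σ • Q = Q := by
      rw [W.smul_oneRootHalving hs σ hu₁ hu₂ hu₃ hu₁ hv₂ hv₃ e1 h₂₃ hQ, hQ]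
    refine ⟨1, Or.inl rfl, ?_, by rw [one_mul]; exact e1, by rw [one_mul, hprod₂₃, e2, e3]⟩
    simp only [hσ, sub_self, true_or, if_true, Units.val_one]
  · -- `σQ = Q + T_θ`
    have hσ : σ • Q = Q + W.geomOneRoot h := by
      rw [W.smul_oneRootHalving hs σ hu₁ hu₂ hu₃ hu₁ hv₂ hv₃ e1 h₂₃ hQ, hQ, hT]
      exact (Affine.Point.halving_add_twoTorsion₁ hs hu₁ hu₂ hu₃).symm
    refine ⟨1, Or.inl rfl, ?_, by rw [one_mul]; exact e1, by rw [one_mul, hprod₂₃, e2, e3]; ring⟩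
    simp only [hσ, add_sub_cancel_left, or_true, if_true, Units.val_one]
  · -- `σQ = Q + T₂`
    rw [e1] at hv₁
    have hσ : σ • Q = Q + T₂ := by
      rw [W.smul_oneRootHalving hs σ hu₁ hu₂ hu₃ hv₁ hv₂ hv₃ e1 h₂₃ hQ, hQ, hT₂]
      exact (Affine.Point.halving_add_twoTorsion₂ hs hu₁ hu₂ hu₃).symm
    refine ⟨-1, Or.inr rfl, ?_, by rw [neg_one_mul]; exact e1, by rw [hprod₂₃, e2, e3]; ring⟩
    simp only [hσ, add_sub_cancel_left, h20, h21, or_self, if_false, Units.val_neg, Units.val_one]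
  · -- `σQ = Q + T₃`
    rw [e1] at hv₁
    have hσ : σ • Q = Q + T₃ := by
      rw [W.smul_oneRootHalving hs σ hu₁ hu₂ hu₃ hv₁ hv₂ hv₃ e1 h₂₃ hQ, hQ, hT₃]
      exact (Affine.Point.halving_add_twoTorsion₃ hs hu₁ hu₂ hu₃).symm
    refine ⟨-1, Or.inr rfl, ?_, by rw [neg_one_mul]; exact e1, by rw [hprod₂₃, e2, e3]; ring⟩
    simp only [hσ, add_sub_cancel_left, h30, h31, or_self, if_false, Units.val_neg, Units.val_one]

/-! ### The main identity: `H¹(χ_θ) ∘ κ` is the one-root descent component `x − θ` -/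

/-- **`H¹(χ_θ)` of a Kummer class is a Kummer class of `μ₂`**, whenever the two cocycles agree
pointwise: if `χ_θ(σQ − Q) = σ(α)/α` for all `σ` then `H¹(χ_θ)[σ ↦ σQ − Q] = [σ ↦ σ(α)/α]`.
[cite: SerreGaloisCohomology1997, I.§2.4] -/
theorem oneRootCharH1_kummerClassTorsion (h : W.toAffine.IsTwoTorsionX θ) (Q : geomPoints W)
    (hQ : (2 : ℤ) • Q ∈ MulAction.fixedPoints (absoluteGaloisGroup K) (geomPoints W))
    (α : kummerUnits K 2)
    (hval : ∀ σ : absoluteGaloisGroup K,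
      muVal K 2 (W.oneRootChar h ⟨σ • Q - Q, smul_sub_mem_geomTorsion hQ σ⟩) =
        σ • (α : (AlgebraicClosure K)ˣ) / α) :
    W.oneRootCharH1 h (kummerClassTorsion W 2 Q hQ) = (kummerClassHom K 2 α).toAdd := by
  unfold kummerClassTorsion
  rw [oneRootCharH1_oneCocycleClass, kummerClassHom_apply, toAdd_ofAdd]
  congr 1
  apply Subtype.ext
  ext σ
  apply muVal_injective K 2
  rw [kummerOneCocycle_apply, muVal_kummerOneCocycleFun]
  exact hval σ

/-- **The one-root descent map is the Kummer map, generic point** (Silverman AEC Thm. X.1.1 for one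
rational root; Cassels §15 `μ(a, b) = a − Θ`): for `P = (x₀, y₀) ∈ E(K)` with `x₀ ≠ θ`,
`H¹(χ_θ)(κ(P)) ∈ H¹(K, μ₂)` is the Kummer class of `x₀ − θ ∈ Kˣ` (computed on the explicit halving point
over `K̄`; `χ_θ(σQ − Q) = σ(u₁)/u₁` with `u₁ = √(x₀ − θ)`).
[cite: SilvermanAEC2009, Thm. X.1.1, Prop. X.1.4] [cite: Cassels1991LecturesEllipticCurves, §15 (ii)] -/
theorem oneRootCharH1_kummerMapTorsion_of_ne (h : W.toAffine.IsTwoTorsionX θ)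
    (hdiv : ∀ P : geomPoints W, ∃ Q : geomPoints W, (2 : ℤ) • Q = P) {x₀ y₀ : K}
    (h₀ : W.toAffine.Nonsingular x₀ y₀) (hx : x₀ ≠ θ) :
    W.oneRootCharH1 h (kummerMapTorsion W 2 hdiv (Affine.Point.some x₀ y₀ h₀)) =
      (kummerMap K 2 (Units.mk0 (x₀ - θ) (sub_ne_zero.mpr hx))).toAdd := by
  haveI := W.isElliptic_baseChange (AlgebraicClosure K)
  -- one root splits the cubic over `K̄`
  obtain ⟨e₂, e₃, hs⟩ := (W.isTwoTorsionX_baseChange h (AlgebraicClosure K)).exists_splitTwoTorsion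
  -- the halving data over `K̄`
  have h₀' : (W.baseChange (AlgebraicClosure K)).toAffine.Nonsingular
      (algebraMap K (AlgebraicClosure K) x₀) (algebraMap K (AlgebraicClosure K) y₀) :=
    (Affine.map_nonsingular (W := W.toAffine) (algebraMap K (AlgebraicClosure K)).injective x₀
      y₀).mpr h₀
  obtain ⟨u₁, u₂, u₃, hu₁, hu₂, hu₃, hy⟩ := Affine.Point.exists_halving_roots hs h₀'.1
  have hy' : algebraMap K (AlgebraicClosure K) (y₀ + (W.a₁ * x₀ + W.a₃) / 2) = u₁ * u₂ * u₃ := by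
    rw [← hy]
    simp only [map_add, map_div₀, map_mul, map_ofNat, baseChange, map_a₁, map_a₃]
  have hu₁0 : u₁ ≠ 0 := by
    intro h0
    rw [h0, zero_pow two_ne_zero, sub_eq_zero] at hu₁
    exact hx ((algebraMap K (AlgebraicClosure K)).injective hu₁)
  -- the Kummer unit `u₁`
  have hu₁K : algebraMap K (AlgebraicClosure K) (x₀ - θ) = u₁ ^ 2 := by rw [map_sub]; exact hu₁
  have hα : Units.mk0 u₁ hu₁0 ∈ kummerUnits K 2 := by
    intro σ
    ext
    rw [Units.coe_smul, Units.val_pow_eq_pow_val, Units.val_mk0, ← hu₁K]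
    exact (show AlgebraicClosure K ≃ₐ[K] AlgebraicClosure K from σ).commutes _
  set α : kummerUnits K 2 := ⟨Units.mk0 u₁ hu₁0, hα⟩ with hαdef
  -- the Kummer map at `x₀ − θ` is the Kummer class of `u₁`
  have hroot : kummerMap K 2 (Units.mk0 (x₀ - θ) (sub_ne_zero.mpr hx)) = kummerClassHom K 2 α := by
    rw [kummerMap_apply]
    apply kummerClassHom_eq_of_pow_eq
    rw [kummerUnitsRoot_pow]
    ext
    rw [Units.coe_map, MonoidHom.coe_coe, Units.val_mk0, hαdef, Units.val_pow_eq_pow_val,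
      Units.val_mk0, ← hu₁K]
  set Q : geomPoints W := Affine.Point.some _ _ (W.nonsingular_oneRootHalving hs hu₁ hu₂ hu₃) with hQdef
  have hQ2 := W.two_zsmul_oneRootHalving hs h₀ hu₁ hu₂ hu₃ hy' hQdef
  have hQfix : (2 : ℤ) • Q ∈ MulAction.fixedPoints (absoluteGaloisGroup K) (geomPoints W) := by
    rw [hQ2]; exact toGeomPoints_mem_fixedPoints W _
  rw [hroot, kummerMapTorsion_apply, kummerMapTorsionFun_eq W 2 hdiv _ Q hQ2]
  refine W.oneRootCharH1_kummerClassTorsion h Q hQfix α fun σ => ?_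
  obtain ⟨s, -, hs', hs₁, -⟩ := W.exists_sign_muVal_oneRootChar_smul_halving_sub h hs σ hu₁ hu₂ hu₃ hy'
    hQdef (smul_sub_mem_geomTorsion hQfix σ)
  ext
  rw [hs', Units.val_div_eq_div_val, Units.coe_smul, hαdef, Units.val_mk0, hs₁,
    mul_div_cancel_right₀ _ hu₁0]

omit [W.IsElliptic] in
/-- `(u₂u₃)² = c(θ)` at `x₀ = θ`: the product of the other two square roots squares to
`(θ − e₂)(θ − e₃) = 3θ² + (b₂/2)θ + b₄/2 = oneRootConst θ`. [cite: Cassels1991LecturesEllipticCurves, §15 (iii)] -/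
theorem halving_root₂_mul_root₃_sq_eq {e₂ e₃ : AlgebraicClosure K}
    (hs : (W.baseChange (AlgebraicClosure K)).toAffine.SplitTwoTorsion
      (algebraMap K (AlgebraicClosure K) θ) e₂ e₃)
    {u₂ u₃ : AlgebraicClosure K}
    (hu₂ : algebraMap K (AlgebraicClosure K) θ - e₂ = u₂ ^ 2)
    (hu₃ : algebraMap K (AlgebraicClosure K) θ - e₃ = u₃ ^ 2) :
    (u₂ * u₃) ^ 2 = algebraMap K (AlgebraicClosure K) (W.toAffine.oneRootConst θ) := by
  have hS := W.root₂_add_root₃_eq hs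
  have hP := W.root₂_mul_root₃_eq hs
  have hc : W.toAffine.oneRootConst θ =
      θ ^ 2 - θ * (-(W.b₂ / 4) - θ) + (θ ^ 2 + W.b₂ / 4 * θ + W.b₄ / 2) := by
    simp only [Affine.oneRootConst]
    ring
  rw [hc, map_add, map_sub, map_pow, map_mul, ← hS, ← hP, mul_pow, ← hu₂, ← hu₃]
  ring

/-- **The one-root descent map is the Kummer map at `T_θ`**: for `P = (θ, y₀)` (necessarily `T_θ`),
`H¹(χ_θ)(κ(P))` is the Kummer class of `c(θ) = 3θ² + (b₂/2)θ + b₄/2` (the halving point has `u₁ = 0`, and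
`χ_θ(σQ − Q) = σ(u₂u₃)/(u₂u₃)` with `(u₂u₃)² = c(θ)`; Cassels' "patched" component).
[cite: SilvermanAEC2009, Thm. X.1.1, Prop. X.1.4] [cite: Cassels1991LecturesEllipticCurves, §15 (iii)] -/
theorem oneRootCharH1_kummerMapTorsion_of_eq (h : W.toAffine.IsTwoTorsionX θ)
    (hdiv : ∀ P : geomPoints W, ∃ Q : geomPoints W, (2 : ℤ) • Q = P) {x₀ y₀ : K}
    (h₀ : W.toAffine.Nonsingular x₀ y₀) (hx : x₀ = θ) :
    W.oneRootCharH1 h (kummerMapTorsion W 2 hdiv (Affine.Point.some x₀ y₀ h₀)) =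
      (kummerMap K 2 (Units.mk0 (W.toAffine.oneRootConst θ) h.oneRootConst_ne_zero)).toAdd := by
  haveI := W.isElliptic_baseChange (AlgebraicClosure K)
  subst hx
  obtain ⟨e₂, e₃, hs⟩ := (W.isTwoTorsionX_baseChange h (AlgebraicClosure K)).exists_splitTwoTorsion
  have h₀' : (W.baseChange (AlgebraicClosure K)).toAffine.Nonsingular
      (algebraMap K (AlgebraicClosure K) x₀) (algebraMap K (AlgebraicClosure K) y₀) :=
    (Affine.map_nonsingular (W := W.toAffine) (algebraMap K (AlgebraicClosure K)).injective x₀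
      y₀).mpr h₀
  obtain ⟨u₁, u₂, u₃, hu₁, hu₂, hu₃, hy⟩ := Affine.Point.exists_halving_roots hs h₀'.1
  have hy' : algebraMap K (AlgebraicClosure K) (y₀ + (W.a₁ * x₀ + W.a₃) / 2) = u₁ * u₂ * u₃ := by
    rw [← hy]
    simp only [map_add, map_div₀, map_mul, map_ofNat, baseChange, map_a₁, map_a₃]
  have hsq : (u₂ * u₃) ^ 2 = algebraMap K (AlgebraicClosure K) (W.toAffine.oneRootConst x₀) :=
    W.halving_root₂_mul_root₃_sq_eq hs hu₂ hu₃
  have hu0 : u₂ * u₃ ≠ 0 := by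
    intro h0
    rw [h0, zero_pow two_ne_zero, eq_comm, map_eq_zero] at hsq
    exact h.oneRootConst_ne_zero hsq
  -- the Kummer unit `u₂u₃`
  have hα : Units.mk0 (u₂ * u₃) hu0 ∈ kummerUnits K 2 := by
    intro σ
    ext
    rw [Units.coe_smul, Units.val_pow_eq_pow_val, Units.val_mk0, hsq]
    exact (show AlgebraicClosure K ≃ₐ[K] AlgebraicClosure K from σ).commutes _
  set α : kummerUnits K 2 := ⟨Units.mk0 (u₂ * u₃) hu0, hα⟩ with hαdef
  have hroot : kummerMap K 2 (Units.mk0 (W.toAffine.oneRootConst x₀) h.oneRootConst_ne_zero) =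
      kummerClassHom K 2 α := by
    rw [kummerMap_apply]
    apply kummerClassHom_eq_of_pow_eq
    rw [kummerUnitsRoot_pow]
    ext
    rw [Units.coe_map, MonoidHom.coe_coe, Units.val_mk0, hαdef, Units.val_pow_eq_pow_val,
      Units.val_mk0, hsq]
  set Q : geomPoints W := Affine.Point.some _ _ (W.nonsingular_oneRootHalving hs hu₁ hu₂ hu₃) with hQdef
  have hQ2 := W.two_zsmul_oneRootHalving hs h₀ hu₁ hu₂ hu₃ hy' hQdef
  have hQfix : (2 : ℤ) • Q ∈ MulAction.fixedPoints (absoluteGaloisGroup K) (geomPoints W) := by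
    rw [hQ2]; exact toGeomPoints_mem_fixedPoints W _
  rw [hroot, kummerMapTorsion_apply, kummerMapTorsionFun_eq W 2 hdiv _ Q hQ2]
  refine W.oneRootCharH1_kummerClassTorsion h Q hQfix α fun σ => ?_
  obtain ⟨s, -, hs', -, hs₂⟩ := W.exists_sign_muVal_oneRootChar_smul_halving_sub h hs σ hu₁ hu₂ hu₃ hy'
    hQdef (smul_sub_mem_geomTorsion hQfix σ)
  ext
  rw [hs', Units.val_div_eq_div_val, Units.coe_smul, hαdef, Units.val_mk0, hs₂,
    mul_div_cancel_right₀ _ hu0]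

/-- **The one-root descent map is the Kummer map at `O`** (both vanish). [cite: SilvermanAEC2009, Prop. X.1.4] -/
theorem oneRootCharH1_kummerMapTorsion_zero (h : W.toAffine.IsTwoTorsionX θ)
    (hdiv : ∀ P : geomPoints W, ∃ Q : geomPoints W, (2 : ℤ) • Q = P) :
    W.oneRootCharH1 h (kummerMapTorsion W 2 hdiv 0) = (kummerMap K 2 1).toAdd := by
  rw [map_zero, map_zero, map_one]
  rfl

/-- **THE ONE-ROOT `2`-DESCENT MAP IS THE KUMMER MAP** (Cassels §15 / Silverman AEC X.1.1 & X.1.4 for one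
rational root): for every `P ∈ E(K)`, the image of the Kummer class `κ(P) ∈ H¹(K, E[2])` under `H¹(χ_θ)`
followed by Kummer theory `H¹(K, μ₂) ≃ Kˣ/Kˣ²` is Cassels' one-root component `oneRootComponent θ P`:
`x(P) − θ` for `x(P) ≠ θ`, `c(θ)` at `T_θ`, `1` at `O` (modulo squares).
[cite: Cassels1991LecturesEllipticCurves, §15 (the map μ)] [cite: SilvermanAEC2009, Thm. X.1.1, Prop. X.1.4] -/
theorem kummerEquiv_oneRootCharH1_kummerMapTorsion (h : W.toAffine.IsTwoTorsionX θ)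
    (hdiv : ∀ P : geomPoints W, ∃ Q : geomPoints W, (2 : ℤ) • Q = P) (P : W.toAffine.Point) :
    kummerEquiv K 2 (W.oneRootCharH1 h (kummerMapTorsion W 2 hdiv P)) =
      Additive.ofMul (Affine.Point.oneRootComponent W.toAffine θ P) := by
  rcases P with _ | ⟨x₀, y₀, h₀⟩
  · rw [← Affine.Point.zero_def, W.oneRootCharH1_kummerMapTorsion_zero h hdiv, kummerEquiv_kummerMap,
      Affine.Point.oneRootComponent_zero, QuotientGroup.mk_one]
  · by_cases hx : x₀ = θ
    · rw [W.oneRootCharH1_kummerMapTorsion_of_eq h hdiv h₀ hx, kummerEquiv_kummerMap,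
        Affine.Point.oneRootComponent_some_of_eq _ hx, Affine.sqClass_of_ne_zero h.oneRootConst_ne_zero]
    · rw [W.oneRootCharH1_kummerMapTorsion_of_ne h hdiv h₀ hx, kummerEquiv_kummerMap,
        Affine.Point.oneRootComponent_some_of_ne _ hx, Affine.sqClass_of_ne_zero (sub_ne_zero.mpr hx)]

/-- **Hom form**: `kummerEquiv ∘ H¹(χ_θ) ∘ κ = oneRootHom` as additive homomorphisms `E(K) →+ Kˣ/Kˣ²`
(Cassels' `μ` restricted to its `θ`-component IS the cohomological descent map).
[cite: Cassels1991LecturesEllipticCurves, §15 Lemma 1] -/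
theorem kummerEquiv_oneRootCharH1_kummerMapTorsion_eq_oneRootHom (h : W.toAffine.IsTwoTorsionX θ)
    (hdiv : ∀ P : geomPoints W, ∃ Q : geomPoints W, (2 : ℤ) • Q = P) (P : W.toAffine.Point) :
    kummerEquiv K 2 (W.oneRootCharH1 h (kummerMapTorsion W 2 hdiv P)) =
      Affine.Point.oneRootHom W.toAffine h P := by
  rw [Affine.Point.oneRootHom_apply]
  exact W.kummerEquiv_oneRootCharH1_kummerMapTorsion h hdiv P

/-- **The image of `κ(E(K))` under `kummerEquiv ∘ H¹(χ_θ)` is killed by... it kills `2E(K)`** and, more to the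
point for descent, two rational points with the same Kummer class have the same one-root component: the
one-root component factors through `E(K)/2E(K) ↪ H¹(K, E[2])`.
[cite: Cassels1991LecturesEllipticCurves, §15 Lemma 2] -/
theorem oneRootComponent_eq_of_kummerMapTorsion_eq (h : W.toAffine.IsTwoTorsionX θ)
    (hdiv : ∀ P : geomPoints W, ∃ Q : geomPoints W, (2 : ℤ) • Q = P) {P P' : W.toAffine.Point}
    (hPP' : kummerMapTorsion W 2 hdiv P = kummerMapTorsion W 2 hdiv P') :
    Affine.Point.oneRootComponent W.toAffine θ P = Affine.Point.oneRootComponent W.toAffine θ P' := by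
  have h1 := W.kummerEquiv_oneRootCharH1_kummerMapTorsion h hdiv P
  have h2 := W.kummerEquiv_oneRootCharH1_kummerMapTorsion h hdiv P'
  rw [hPP', h2] at h1
  exact Additive.ofMul.injective h1.symm

end WeierstrassCurve

end
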